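import Summits.NavierStokesRegularity.FluidComputer.GradientSerrinFace
import Literature.Analysis.FluidPDE.BeiraoDaVeigaVorticityCriterion
import HarnessLib

/-!
# Fluid computer — the level dictionary, VORTICITY SERRIN FACE (L47′): the vorticity leaves every class
# `L^q_t L^r_x`, `2/q + 3/r = 2`, `3/2 < r < ∞` (Beirão da Veiga, vorticity form)

HONEST FRAMING (cell `pub-fluidc`, verbatim): *low prior, high value-of-information experiment on Tao's
machine paradigm; NOT a claim that NS blows up.* Theorem side of the cell; nothing here is evidence of blow-up.
L47 (`GradientSerrinFace`) states Beirão da Veiga's ladder for `∇u`; the quantity a DNS monitors is the VORTICITY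
`ω = curl u`. The div–curl (Calderón–Zygmund) estimate `‖∇u(t)‖_{L^r} ≤ C_r ‖ω(t)‖_{L^r}` for smooth divergence-free
fields with the appropriate tail (PROVED in the tree: `exists_eLpNorm_fderiv_le_curl_of_isDivFree_of_eLpNorm_lt_top`,
`eLpNorm_lt_top_of_curl_of_six_lt`) converts the ladder into vorticity currency, exactly as the tree's
`BeiraoDaVeiga1995_vorticityCriterion` does for rapidly decaying data (a binder the proof does not use; here
bypassed). For every maximal smooth solution `(u, p)` of the unforced Navier–Stokes system on `ℝ³ × [0, T)`
(`ν > 0`), Leray–Hopf from `u 0`: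

* `eLpNorm_fderiv_two_lt_top_slice` (tool): `∇u(t) ∈ L²` (operator norm) at every `t ∈ (0, T)`;
* `not_memLqLp_curl(_window)` (**L47′ — THE VORTICITY LEAVES EVERY SERRIN CLASS**): for all `1 < q < ∞`,
  `2/q + 3/r = 2` (so `3/2 < r < ∞`) and every `t₀ ∈ [0, T)`: `ω ∉ L^q(t₀, T; L^r(ℝ³))`, i.e.
  `∫_{t₀}^{T} ‖ω(t)‖_{L^r}^q dt = ∞` — `r = 2, q = 4`: `∫Z² = ∞` (L30‴); `r = 3, q = 2`: `∫‖ω‖²_{L³} = ∞`; the endpoint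
  `r = ∞, q = 1` is the BKM face L31;
* `vorticity_serrin_face`: assembled.

Reading for the machine paradigm (words): every `L^r`-moment of the vorticity, `3/2 < r < ∞`, must in the mean grow
at least like `(T − t)^{−(2r−3)/(2r)}` on every terminal window; a run whose vorticity moments stay integrable at
the Serrin exponents is not approaching a singularity. Class statements; no constants. Necessity only. 0 sorry; no
new definitions, no named facts.

## References

* H. Beirão da Veiga, C. R. Acad. Sci. Paris 321 (1995) 405–408; Chinese Ann. Math. Ser. B 16 (1995) 407–412.
  [BeiraoDaVeiga1995]
* A. J. Majda, A. L. Bertozzi, *Vorticity and Incompressible Flow*, CUP 2002, (11.9). [MajdaBertozziCUP2002]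
* J. T. Beale, T. Kato, A. Majda, Comm. Math. Phys. 94 (1984) 61–66. [BealeKatoMajda1984]
-/

noncomputable section

open MeasureTheory Set Function Filter Topology Metric
open scoped ENNReal NNReal ContDiff
open Literature.Analysis.FluidPDE Literature.Analysis.FunctionSpaces
open Literature.Analysis.FluidPDE.LPBounds (gradSq)
open Summit.NavierStokesRegularity.FluidComputer.LerayClock
open Summit.NavierStokesRegularity.FluidComputer.GradientSerrinFace

namespace Summit.NavierStokesRegularity.FluidComputer.VorticitySerrinFace

/-- **The gradient of every interior slice is square integrable (operator norm)**: for a maximal smooth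
Leray–Hopf solution and `t ∈ (0, T)`, `‖∇u(t)‖_{L²} < ∞` — the Frobenius enstrophy is finite
(`LerayClock.lintegral_frobeniusNormSq_eq_gradSq`) and `‖A‖_op² ≤ |A|²_F` (`sq_opNorm_le_frobeniusNormSq`).
[folklore] -/
theorem eLpNorm_fderiv_two_lt_top_slice {ν T : ℝ} (hν : 0 < ν) (hT : 0 < T)
    {u : ℝ → EuclideanSpace ℝ (Fin 3) → EuclideanSpace ℝ (Fin 3)} {p : ℝ → EuclideanSpace ℝ (Fin 3) → ℝ}
    (hmax : IsMaximalSmoothSolution ν 0 u p T) (hLH : IsLerayHopfOn T ν 0 (u 0) u)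
    {t : ℝ} (ht : t ∈ Ioo 0 T) : eLpNorm (fderiv ℝ (u t)) 2 volume < ⊤ := by
  obtain ⟨hZ, hZtop⟩ := lintegral_frobeniusNormSq_eq_gradSq hν hT hmax hLH ht
  have hfin : (∫⁻ x, ENNReal.ofReal (frobeniusNormSq (fderiv ℝ (u t) x))) < ⊤ := by
    rw [hZ]; exact lt_top_iff_ne_top.2 hZtop
  have hle : (∫⁻ x, ‖fderiv ℝ (u t) x‖ₑ ^ 2) ≤
      ∫⁻ x, ENNReal.ofReal (frobeniusNormSq (fderiv ℝ (u t) x)) :=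
    lintegral_mono fun x => by
      rw [← ofReal_norm, ← ENNReal.ofReal_pow (norm_nonneg _)]
      exact ENNReal.ofReal_le_ofReal (sq_opNorm_le_frobeniusNormSq _)
  rw [eLpNorm_lt_top_iff_lintegral_rpow_enorm_lt_top (by norm_num) (by norm_num)]
  simp only [ENNReal.toReal_ofNat, ENNReal.rpow_two]
  exact hle.trans_lt hfin

/-- **L47′ — `ω ∉ L^q(0, T; L^r)`, `2/q + 3/r = 2`, `1 < q < ∞`** (Beirão da Veiga 1995, vorticity form, on the
class): the div–curl estimate with the `L²` tail (`r ≤ 2`), the `L⁶` tail (`2 < r ≤ 6`, Sobolev from `∇u(t) ∈ L²`)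
or the `L^r` tail (`r > 6`, `eLpNorm_lt_top_of_curl_of_six_lt`) bounds `‖∇u(t)‖_{L^r} ≤ C‖ω(t)‖_{L^r}` at every
`t ∈ (0, T)`, so `ω ∈ L^qL^r` would put `∇u ∈ L^qL^r`, against L47 (`GradientSerrinFace.not_memLqLp_gradient`).
[cite: BeiraoDaVeiga1995, Thm 1] [cite: MajdaBertozziCUP2002, Ch. 11 (11.9)] -/
theorem not_memLqLp_curl {ν T : ℝ} (hν : 0 < ν) (hT : 0 < T)
    {u : ℝ → EuclideanSpace ℝ (Fin 3) → EuclideanSpace ℝ (Fin 3)} {p : ℝ → EuclideanSpace ℝ (Fin 3) → ℝ}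
    (hmax : IsMaximalSmoothSolution ν 0 u p T) (hLH : IsLerayHopfOn T ν 0 (u 0) u)
    {q r : ℝ≥0∞} (h1q : 1 < q) (hqtop : q < ⊤) (hqr : 2 / q + 3 / r = 2) :
    ¬ MemLqLp q r (fun t x => curl (u t) x) (Ioo 0 T) := by
  intro hω
  obtain ⟨hrtop, hr32, -⟩ := bdv_exponents h1q hqtop hqr
  have h32top : (3 / 2 : ℝ≥0∞) ≠ ⊤ := ENNReal.div_ne_top (by norm_num) (by norm_num)
  have h32 : (3 / 2 : ℝ) < r.toReal := by
    have h := (ENNReal.toReal_lt_toReal h32top hrtop).2 hr32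
    rw [ENNReal.toReal_div] at h
    norm_num at h
    exact h
  have h1r : 1 < r :=
    (ENNReal.toReal_lt_toReal ENNReal.one_ne_top hrtop).1 (by rw [ENNReal.toReal_one]; linarith)
  have hrinv : 1 / r.toReal < 2 / 3 := by
    rw [div_lt_div_iff₀ (by linarith) (by norm_num)]
    linarith
  -- slice data at every `t ∈ (0, T)`
  have hsl : ∀ t ∈ Ioo 0 T, ContDiff ℝ ∞ (u t) ∧ VectorCalculus.IsDivFree (u t) ∧
      eLpNorm (u t) 2 volume < ⊤ ∧ eLpNorm (fderiv ℝ (u t)) 2 volume < ⊤ := fun t ht =>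
    ⟨hmax.1.contDiff_velocity (Ioo_subset_Ico_self ht), hmax.1.divFree t (Ioo_subset_Ico_self ht),
      (hLH.memLp t ⟨ht.1.le, ht.2.le⟩).eLpNorm_lt_top, eLpNorm_fderiv_two_lt_top_slice hν hT hmax hLH ht⟩
  -- the slice bound `‖∇u(t)‖_r ≤ C ‖ω(t)‖_r`
  have key : ∃ C : ℝ≥0, ∀ᵐ t ∂(volume.restrict (Ioo 0 T)),
      eLpNorm (fderiv ℝ (u t)) r volume ≤ C * eLpNorm (curl (u t)) r volume := by
    by_cases hr2 : r ≤ 2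
    · -- energy class: `L²` tail
      obtain ⟨C, hC⟩ := exists_eLpNorm_fderiv_le_curl_of_isDivFree_of_eLpNorm_lt_top (s := 2)
        h1r hr2 (by norm_num) (by simp only [ENNReal.toReal_ofNat]; linarith)
      refine ⟨C, ?_⟩
      filter_upwards [ae_restrict_mem measurableSet_Ioo] with t ht
      obtain ⟨h1, h2, h3, -⟩ := hsl t ht
      exact hC (u t) h1 h2 h3
    rw [not_le] at hr2
    by_cases hr6 : r ≤ 6
    · -- `2 < r ≤ 6`: `L⁶` tail by Sobolev from `∇u(t) ∈ L²`
      have hrinv' : 1 / r.toReal < 1 / 2 := by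
        have h2r : (2 : ℝ) < r.toReal := by
          have h := (ENNReal.toReal_lt_toReal ENNReal.ofNat_ne_top hrtop).2 hr2
          simpa using h
        rw [div_lt_div_iff₀ (by linarith) (by norm_num)]
        linarith
      obtain ⟨C, hC⟩ := exists_eLpNorm_fderiv_le_curl_of_isDivFree_of_eLpNorm_lt_top (s := 6)
        h1r hr6 (by norm_num) (by simp only [ENNReal.toReal_ofNat]; linarith)
      refine ⟨C, ?_⟩
      filter_upwards [ae_restrict_mem measurableSet_Ioo] with t ht
      obtain ⟨h1, h2, h3, hDt⟩ := hsl t ht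
      have h6 : eLpNorm (u t) 6 volume < ⊤ := by
        refine lt_of_le_of_lt (eLpNorm_six_le_eLpNorm_fderiv_two
          (volume : Measure (EuclideanSpace ℝ (Fin 3))) (F := EuclideanSpace ℝ (Fin 3))
          finrank_euclideanSpace_fin (h1.of_le one_le_infty) h3) ?_
        exact ENNReal.mul_lt_top ENNReal.coe_lt_top hDt
      exact hC (u t) h1 h2 h6
    · -- `r > 6`: `L^r` tail from interpolation / Morrey
      rw [not_le] at hr6
      obtain ⟨C, hC⟩ := exists_eLpNorm_fderiv_le_curl_of_isDivFree_of_eLpNorm_lt_top (p := r) (s := r)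
        h1r le_rfl hrtop.lt_top (by simp)
      obtain ⟨hω1, -⟩ := hω
      refine ⟨C, ?_⟩
      filter_upwards [ae_restrict_mem measurableSet_Ioo, hω1] with t ht hωt
      obtain ⟨h1, h2, h3, hDt⟩ := hsl t ht
      exact hC (u t) h1 h2 (eLpNorm_lt_top_of_curl_of_six_lt hr6 hrtop h1 h2 h3 hDt hωt.eLpNorm_lt_top)
  obtain ⟨C, hC⟩ := key
  -- `∇u ∈ L^q(0,T; L^r)`
  have hgrad : MemLqLp q r (fun t x => fderiv ℝ (u t) x) (Ioo 0 T) := by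
    obtain ⟨hω1, hω2⟩ := hω
    refine ⟨?_, ?_⟩
    · filter_upwards [hC, hω1, ae_restrict_mem measurableSet_Ioo] with t ht hωt htI
      have hcont : Continuous (fderiv ℝ (u t)) :=
        (hmax.1.contDiff_velocity (Ioo_subset_Ico_self htI)).continuous_fderiv (by simp)
      exact ⟨hcont.aestronglyMeasurable,
        lt_of_le_of_lt ht (ENNReal.mul_lt_top ENNReal.coe_lt_top hωt.eLpNorm_lt_top)⟩
    · rw [eLqLpNorm_def] at hω2 ⊢
      have hmono : eLpNorm (fun t => (eLpNorm (fun x => fderiv ℝ (u t) x) r volume).toReal) q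
          (volume.restrict (Ioo 0 T)) ≤
          eLpNorm (fun t => (C : ℝ) * (eLpNorm (fun x => curl (u t) x) r volume).toReal) q
            (volume.restrict (Ioo 0 T)) := by
        refine eLpNorm_mono_ae ?_
        filter_upwards [hC, hω1] with t ht hωt
        rw [Real.norm_of_nonneg ENNReal.toReal_nonneg, Real.norm_of_nonneg (by positivity)]
        have hfin : (C : ℝ≥0∞) * eLpNorm (curl (u t)) r volume ≠ ⊤ :=
          ENNReal.mul_ne_top ENNReal.coe_ne_top hωt.eLpNorm_lt_top.ne
        have := ENNReal.toReal_mono hfin ht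
        rwa [ENNReal.toReal_mul, ENNReal.coe_toReal] at this
      refine lt_of_le_of_lt hmono ?_
      rw [show (fun t => (C : ℝ) * (eLpNorm (fun x => curl (u t) x) r volume).toReal) =
          (C : ℝ) • fun t => (eLpNorm (fun x => curl (u t) x) r volume).toReal from rfl,
        eLpNorm_const_smul]
      exact ENNReal.mul_lt_top enorm_lt_top hω2
  exact not_memLqLp_gradient hν hT hmax hLH h1q hqtop hqr hgrad

/-- **L47′ ON EVERY TERMINAL WINDOW**: for every `t₀ ∈ [0, T)`, `ω ∉ L^q(t₀, T; L^r)` (restart at an a.e.-good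
time, `MemLqLp.translate`). [cite: BeiraoDaVeiga1995, Thm 1] -/
theorem not_memLqLp_curl_window {ν T : ℝ} (hν : 0 < ν)
    {u : ℝ → EuclideanSpace ℝ (Fin 3) → EuclideanSpace ℝ (Fin 3)} {p : ℝ → EuclideanSpace ℝ (Fin 3) → ℝ}
    (hmax : IsMaximalSmoothSolution ν 0 u p T) (hLH : IsLerayHopfOn T ν 0 (u 0) u)
    {q r : ℝ≥0∞} (h1q : 1 < q) (hqtop : q < ⊤) (hqr : 2 / q + 3 / r = 2)
    {t₀ : ℝ} (ht₀ : t₀ ∈ Ico 0 T) :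
    ¬ MemLqLp q r (fun t x => curl (u t) x) (Ioo t₀ T) := by
  intro hS
  obtain ⟨s, hs, hLHs⟩ := hLH.exists_isLerayHopfOn_restart_Ioo hν.le ht₀.1 ht₀.2 le_rfl
  have hs0 : 0 < s := ht₀.1.trans_lt hs.1
  have hTs : 0 < T - s := sub_pos.2 hs.2
  have hmax' : IsMaximalSmoothSolution ν 0 (fun t => u (t + s)) (fun t => p (t + s)) (T - s) :=
    hmax.translate_zero hs0 hs.2
  have hLH' : IsLerayHopfOn (T - s) ν 0 ((fun t => u (t + s)) 0) (fun t => u (t + s)) := by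
    show IsLerayHopfOn (T - s) ν 0 (u (0 + s)) (fun t => u (t + s))
    rw [zero_add]
    exact hLHs
  have hS' : MemLqLp q r (fun t x => curl (u (t + s)) x) (Ioo 0 (T - s)) := by
    have h := hS.mono_set (Ioo_subset_Ioo hs.1.le le_rfl)
    rw [show Ioo s T = Ioo (0 + s) (T - s + s) by rw [zero_add, sub_add_cancel]] at h
    exact h.translate s
  exact not_memLqLp_curl hν hTs hmax' hLH' h1q hqtop hqr hS'

/-- **THE VORTICITY SERRIN FACE, ASSEMBLED**: on every terminal window the vorticity lies in no class `L^q_tL^r_x`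
with `2/q + 3/r = 2`, `1 < q < ∞`. [cite: BeiraoDaVeiga1995, Thm 1] -/
theorem vorticity_serrin_face {ν T : ℝ} (hν : 0 < ν)
    {u : ℝ → EuclideanSpace ℝ (Fin 3) → EuclideanSpace ℝ (Fin 3)} {p : ℝ → EuclideanSpace ℝ (Fin 3) → ℝ}
    (hmax : IsMaximalSmoothSolution ν 0 u p T) (hLH : IsLerayHopfOn T ν 0 (u 0) u) :
    ∀ (q r : ℝ≥0∞), 1 < q → q < ⊤ → 2 / q + 3 / r = 2 → ∀ t₀ ∈ Ico 0 T,
      ¬ MemLqLp q r (fun t x => curl (u t) x) (Ioo t₀ T) :=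
  fun _ _ h1q hqtop hqr _ ht₀ => not_memLqLp_curl_window hν hmax hLH h1q hqtop hqr ht₀

end Summit.NavierStokesRegularity.FluidComputer.VorticitySerrinFace

end
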